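import Summits.CriticalPhenomena.PercolationContinuityZ3.Theorems.PercNearOneGluingNoHeavyLowerTailAntitheticLamCountLemmas
import HarnessLib

/-!
# `NoHeavyLowerTail` (stmt-CriticalPhenomena-4575) — antithetic cluster pairs: LEMMA Λ (the MIX–OS pairing that closes CONJECTURE Δ2 on ears),
# the abstract BOUNDARY COUNT, part 2: the count (prim-hp-2 gen 45; HOME/MEMO-gen45.md §1, HOME/THEOREM-OS-augmentation.md §6–§7)

Support file (`--supports stmt-CriticalPhenomena-4575`, hull-port prover `prim-hp-2`, gen 45).  No definitions, no named facts, no sorries.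

PURE COMBINATORICS (no graphs); setting, names and the four one-change families `1 = (ap,c | bp,d)`, `2 = (a,cp | b,dp)`, `3 = (aP,cA | bP,dA)`,
`4 = (aA,cP | bA,dP)` as in part 1 (…AntitheticLamCountLemmas).  LEMMA Λ: on the cycle through `s` with a marker set `P` at `b`, nested marker sets
`A ⊆ A⁺` at `a`, `Λ = Σ_{T ∈ D(R′)} [Δ(ℓ_P C, ℓ_A C′)
    + Δ(ℓ⁺ C, C′)] ≥ 0`; with THEOREM C′ and THEOREM OS it gives CONJECTURE Δ2 (the change family at a
forbidden degree-2 vertex is nonnegative) at EVERY vertex of every ear hung on a cycle through the source (THEOREM-OS §6–§7).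
* `Antithetic.LamCount.count` — **the boundary count of LEMMA Λ**: for EVERY finite set `I` of positions, #bad one-change terms on `I` ≤ #good
  one-change terms on `I` + Σ over the four arc families (`⁺`-lifted, `P`-lifted, `A`-lifted, plain) of the forced good arcs and full terms
  (`BCount.arcGood`, `BCount.fullGood`).  Hypotheses: ONLY the sandwich inequalities `ap ≤ aP, aA ≤ a`, `cp ≤ cP, cA ≤ c`, `bp ≤ bP, bA ≤ b`,
  `dp ≤ dP, dA ≤ d` and `ap, cp, bp, dp ≥ 1`.
PROOF.  `rawA` / `rawB`: ALL kind-a (resp. ALL kind-b) bad terms together are paid by the arcs — each family's kind-a bad positions lie in a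
"crossed" interval (`card_badA_le`), the four-interval lemma (`four_interval`) trades the crossed lengths for the straight ones, and
`BCount.len_le_good` pays those.  By `dichotomy` one of the two kinds is dominated pointwise by the good one-change terms (`sum4_le`); the other
kind is paid by the arcs.  With the run decomposition of `Λ`, its bulk lemma and the indicator reduction (`Antithetic.Indicator`) this is the
combinatorial core of LEMMA Λ (HOME/MEMO-gen45.md).  Machine-checked before formalisation (n ≤ 6 exhaustive over all thresholds, kit j195193).
[cite: VandenbergHaggstromKahn2005, §1 p. 3 (open cluster `C_s`)]
-/

namespace Summit.CriticalPhenomena.PercolationContinuityZ3.Theorems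

namespace Antithetic

namespace LamCount

variable {n ap aP aA a cp cP cA c bp bP bA b dp dP dA d : ℕ}

/-- Kind-a raw bound: all kind-a bad terms together are paid by the arcs (four-interval lemma). [this work] -/
theorem rawA (I : Finset ℕ) (hs : (ap ≤ aP ∧ aP ≤ a ∧ ap ≤ aA ∧ aA ≤ a ∧ cp ≤ cP ∧ cP ≤ c ∧ cp ≤ cA ∧ cA ≤ c ∧ bp ≤ bP ∧ bP ≤ b ∧ bp ≤ bA ∧ bA ≤ b
    ∧ dp ≤ dP ∧ dP ≤ d ∧ dp ≤ dA ∧ dA ≤ d)) (hp : (1 ≤ ap ∧ 1 ≤ cp ∧ 1 ≤ bp ∧ 1 ≤ dp)) :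
    (I.filter fun i => (ap ≤ i ∧ ¬ c ≤ n - i ∧ ¬ bp ≤ i ∧ d ≤ n - i)).card + (I.filter fun i => (a ≤ i ∧ ¬ cp ≤ n - i ∧ ¬ b ≤ i ∧ dp ≤ n - i)).card
        + (I.filter fun i => (aP ≤ i ∧ ¬ cA ≤ n - i ∧ ¬ bP ≤ i ∧ dA ≤ n - i)).card +
        (I.filter fun i => (aA ≤ i ∧ ¬ cP ≤ n - i ∧ ¬ bA ≤ i ∧ dP ≤ n - i)).card ≤
      ((BCount.arcGood n ap cp bp dp).card + BCount.fullGood n ap cp bp dp) +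
        ((BCount.arcGood n aP cP bP dP).card + BCount.fullGood n aP cP bP dP) +
        ((BCount.arcGood n aA cA bA dA).card + BCount.fullGood n aA cA bA dA) +
        ((BCount.arcGood n a c b d).card + BCount.fullGood n a c b d) := by
  have c1 := card_badA_le (n := n) (u := ap) (w := c) (v := bp) (z := d) I (by omega)
  have c2 := card_badA_le (n := n) (u := a) (w := cp) (v := b) (z := dp) I (by omega)
  have c3 := card_badA_le (n := n) (u := aP) (w := cA) (v := bP) (z := dA) I (by omega)
  have c4 := card_badA_le (n := n) (u := aA) (w := cP) (v := bA) (z := dP) I (by omega)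
  have g1 : n - dp + 1 - ap ≤ (BCount.arcGood n ap cp bp dp).card + BCount.fullGood n ap cp bp dp := by
    have := BCount.len_le_good (n := n) (a := ap) (c := cp) (b := bp) (d := dp) hp.1 hp.2.2.2; omega
  have g2 : n - dP + 1 - aP ≤ (BCount.arcGood n aP cP bP dP).card + BCount.fullGood n aP cP bP dP := by
    have := BCount.len_le_good (n := n) (a := aP) (c := cP) (b := bP) (d := dP) (by omega) (by omega); omega
  have g3 : n - dA + 1 - aA ≤ (BCount.arcGood n aA cA bA dA).card + BCount.fullGood n aA cA bA dA := by
    have := BCount.len_le_good (n := n) (a := aA) (c := cA) (b := bA) (d := dA) (by omega) (by omega); omega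
  have g4 : n - d + 1 - a ≤ (BCount.arcGood n a c b d).card + BCount.fullGood n a c b d := by
    have := BCount.len_le_good (n := n) (a := a) (c := c) (b := b) (d := d) (by omega) (by omega); omega
  have fi := four_interval (fun u r => r + 1 - u) (fun _ _ _ _ hu hr => len_swap hu hr) (u0 := ap) (u1 := aP) (u3 := aA) (u2 := a)
    (r0 := n - dp) (r1 := n - dP) (r3 := n - dA) (r2 := n - d)
    hs.1 hs.2.1 hs.2.2.1 hs.2.2.2.1 (by omega) (by omega) (by omega) (by omega)
  exact (add_le_add (add_le_add (add_le_add c1 c2) c3) c4).trans (fi.trans (add_le_add (add_le_add (add_le_add g1 g2) g3) g4))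

/-- Kind-b raw bound: all kind-b bad terms together are paid by the arcs (four-interval lemma). [this work] -/
theorem rawB (I : Finset ℕ) (hs : (ap ≤ aP ∧ aP ≤ a ∧ ap ≤ aA ∧ aA ≤ a ∧ cp ≤ cP ∧ cP ≤ c ∧ cp ≤ cA ∧ cA ≤ c ∧ bp ≤ bP ∧ bP ≤ b ∧ bp ≤ bA ∧ bA ≤ b
    ∧ dp ≤ dP ∧ dP ≤ d ∧ dp ≤ dA ∧ dA ≤ d)) (hp : (1 ≤ ap ∧ 1 ≤ cp ∧ 1 ≤ bp ∧ 1 ≤ dp)) :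
    (I.filter fun i => (¬ ap ≤ i ∧ c ≤ n - i ∧ bp ≤ i ∧ ¬ d ≤ n - i)).card + (I.filter fun i => (¬ a ≤ i ∧ cp ≤ n - i ∧ b ≤ i ∧ ¬ dp ≤ n - i)).card
        + (I.filter fun i => (¬ aP ≤ i ∧ cA ≤ n - i ∧ bP ≤ i ∧ ¬ dA ≤ n - i)).card +
        (I.filter fun i => (¬ aA ≤ i ∧ cP ≤ n - i ∧ bA ≤ i ∧ ¬ dP ≤ n - i)).card ≤
      ((BCount.arcGood n ap cp bp dp).card + BCount.fullGood n ap cp bp dp) +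
        ((BCount.arcGood n aP cP bP dP).card + BCount.fullGood n aP cP bP dP) +
        ((BCount.arcGood n aA cA bA dA).card + BCount.fullGood n aA cA bA dA) +
        ((BCount.arcGood n a c b d).card + BCount.fullGood n a c b d) := by
  have c1 := card_badB_le (n := n) (u := ap) (w := c) (v := bp) (z := d) I (by omega)
  have c2 := card_badB_le (n := n) (u := a) (w := cp) (v := b) (z := dp) I (by omega)
  have c3 := card_badB_le (n := n) (u := aP) (w := cA) (v := bP) (z := dA) I (by omega)
  have c4 := card_badB_le (n := n) (u := aA) (w := cP) (v := bA) (z := dP) I (by omega)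
  have g1 : n - cp + 1 - bp ≤ (BCount.arcGood n ap cp bp dp).card + BCount.fullGood n ap cp bp dp := by
    have := BCount.len_le_good' (n := n) (a := ap) (c := cp) (b := bp) (d := dp) hp.2.2.1 hp.2.1; omega
  have g2 : n - cP + 1 - bP ≤ (BCount.arcGood n aP cP bP dP).card + BCount.fullGood n aP cP bP dP := by
    have := BCount.len_le_good' (n := n) (a := aP) (c := cP) (b := bP) (d := dP) (by omega) (by omega); omega
  have g3 : n - cA + 1 - bA ≤ (BCount.arcGood n aA cA bA dA).card + BCount.fullGood n aA cA bA dA := by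
    have := BCount.len_le_good' (n := n) (a := aA) (c := cA) (b := bA) (d := dA) (by omega) (by omega); omega
  have g4 : n - c + 1 - b ≤ (BCount.arcGood n a c b d).card + BCount.fullGood n a c b d := by
    have := BCount.len_le_good' (n := n) (a := a) (c := c) (b := b) (d := d) (by omega) (by omega); omega
  have fi := four_interval (fun u r => r + 1 - u) (fun _ _ _ _ hu hr => len_swap hu hr) (u0 := bp) (u1 := bP) (u3 := bA) (u2 := b)
    (r0 := n - cp) (r1 := n - cP) (r3 := n - cA) (r2 := n - c)
    hs.2.2.2.2.2.2.2.2.1 hs.2.2.2.2.2.2.2.2.2.1 hs.2.2.2.2.2.2.2.2.2.2.1 hs.2.2.2.2.2.2.2.2.2.2.2.1 (by omega) (by omega) (by omega) (by omega)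
  exact (add_le_add (add_le_add (add_le_add c1 c2) c3) c4).trans (fi.trans (add_le_add (add_le_add (add_le_add g1 g2) g3) g4))

/-- **THE BOUNDARY COUNT OF LEMMA Λ.**  On every set `I` of positions, #bad one-change terms ≤ #good one-change terms + the forced good arcs and
full terms of the four arc families (`⁺`-lifted, `P`-lifted, `A`-lifted, plain).  Hypotheses: the sandwich inequalities and `ap, cp, bp, dp ≥ 1`.
[this work] -/
theorem count (I : Finset ℕ) (hs : (ap ≤ aP ∧ aP ≤ a ∧ ap ≤ aA ∧ aA ≤ a ∧ cp ≤ cP ∧ cP ≤ c ∧ cp ≤ cA ∧ cA ≤ c ∧ bp ≤ bP ∧ bP ≤ b ∧ bp ≤ bA ∧ bA ≤ b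
    ∧ dp ≤ dP ∧ dP ≤ d ∧ dp ≤ dA ∧ dA ≤ d)) (hp : (1 ≤ ap ∧ 1 ≤ cp ∧ 1 ≤ bp ∧ 1 ≤ dp)) :
    (I.filter fun i => (ap ≤ i ∧ ¬ c ≤ n - i ∧ ¬ bp ≤ i ∧ d ≤ n - i) ∨ (¬ ap ≤ i ∧ c ≤ n - i ∧ bp ≤ i ∧ ¬ d ≤ n - i)).card + (I.filter fun i => (a
        ≤ i ∧ ¬ cp ≤ n - i ∧ ¬ b ≤ i ∧ dp ≤ n - i) ∨ (¬ a ≤ i ∧ cp ≤ n - i ∧ b ≤ i ∧ ¬ dp ≤ n - i)).card +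
        (I.filter fun i => (aP ≤ i ∧ ¬ cA ≤ n - i ∧ ¬ bP ≤ i ∧ dA ≤ n - i) ∨ (¬ aP ≤ i ∧ cA ≤ n - i ∧ bP ≤ i ∧ ¬ dA ≤ n - i)).card
            + (I.filter fun i => (aA ≤ i ∧ ¬ cP ≤ n - i ∧ ¬ bA ≤ i ∧ dP ≤ n - i) ∨ (¬ aA ≤ i ∧ cP ≤ n - i ∧ bA ≤ i ∧ ¬ dP ≤ n - i)).card ≤
      (I.filter fun i => ((ap ≤ i ∧ ¬ c ≤ n - i ∧ bp ≤ i ∧ ¬ d ≤ n - i) ∨ (¬ ap ≤ i ∧ c ≤ n - i ∧ ¬ bp ≤ i ∧ d ≤ n - i))).card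
          + (I.filter fun i => ((a ≤ i ∧ ¬ cp ≤ n - i ∧ b ≤ i ∧ ¬ dp ≤ n - i) ∨ (¬ a ≤ i ∧ cp ≤ n - i ∧ ¬ b ≤ i ∧ dp ≤ n - i))).card
          + (I.filter fun i => ((aP ≤ i ∧ ¬ cA ≤ n - i ∧ bP ≤ i ∧ ¬ dA ≤ n - i) ∨ (¬ aP ≤ i ∧ cA ≤ n - i ∧ ¬ bP ≤ i ∧ dA ≤ n - i))).card
          + (I.filter fun i => ((aA ≤ i ∧ ¬ cP ≤ n - i ∧ bA ≤ i ∧ ¬ dP ≤ n - i) ∨ (¬ aA ≤ i ∧ cP ≤ n - i ∧ ¬ bA ≤ i ∧ dP ≤ n - i))).card +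
      (((BCount.arcGood n ap cp bp dp).card + BCount.fullGood n ap cp bp dp) +
        ((BCount.arcGood n aP cP bP dP).card + BCount.fullGood n aP cP bP dP) +
        ((BCount.arcGood n aA cA bA dA).card + BCount.fullGood n aA cA bA dA) +
        ((BCount.arcGood n a c b d).card + BCount.fullGood n a c b d)) := by
  have s1 : (I.filter fun i => (ap ≤ i ∧ ¬ c ≤ n - i ∧ ¬ bp ≤ i ∧ d ≤ n - i) ∨ (¬ ap ≤ i ∧ c ≤ n - i ∧ bp ≤ i ∧ ¬ d ≤ n - i)).card
      ≤ (I.filter fun i => (ap ≤ i ∧ ¬ c ≤ n - i ∧ ¬ bp ≤ i ∧ d ≤ n - i)).card + (I.filter fun i => (¬ ap ≤ i ∧ c ≤ n - i ∧ bp ≤ i ∧ ¬ d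
      ≤ n - i)).card := by
    rw [Finset.filter_or]; exact Finset.card_union_le _ _
  have s2 : (I.filter fun i => (a ≤ i ∧ ¬ cp ≤ n - i ∧ ¬ b ≤ i ∧ dp ≤ n - i) ∨ (¬ a ≤ i ∧ cp ≤ n - i ∧ b ≤ i ∧ ¬ dp ≤ n - i)).card
      ≤ (I.filter fun i => (a ≤ i ∧ ¬ cp ≤ n - i ∧ ¬ b ≤ i ∧ dp ≤ n - i)).card + (I.filter fun i => (¬ a ≤ i ∧ cp ≤ n - i ∧ b ≤ i ∧ ¬ dp
      ≤ n - i)).card := by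
    rw [Finset.filter_or]; exact Finset.card_union_le _ _
  have s3 : (I.filter fun i => (aP ≤ i ∧ ¬ cA ≤ n - i ∧ ¬ bP ≤ i ∧ dA ≤ n - i) ∨ (¬ aP ≤ i ∧ cA ≤ n - i ∧ bP ≤ i ∧ ¬ dA ≤ n - i)).card
      ≤ (I.filter fun i => (aP ≤ i ∧ ¬ cA ≤ n - i ∧ ¬ bP ≤ i ∧ dA ≤ n - i)).card + (I.filter fun i => (¬ aP ≤ i ∧ cA ≤ n - i ∧ bP ≤ i ∧ ¬ dA
      ≤ n - i)).card := by
    rw [Finset.filter_or]; exact Finset.card_union_le _ _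
  have s4 : (I.filter fun i => (aA ≤ i ∧ ¬ cP ≤ n - i ∧ ¬ bA ≤ i ∧ dP ≤ n - i) ∨ (¬ aA ≤ i ∧ cP ≤ n - i ∧ bA ≤ i ∧ ¬ dP ≤ n - i)).card
      ≤ (I.filter fun i => (aA ≤ i ∧ ¬ cP ≤ n - i ∧ ¬ bA ≤ i ∧ dP ≤ n - i)).card + (I.filter fun i => (¬ aA ≤ i ∧ cP ≤ n - i ∧ bA ≤ i ∧ ¬ dP
      ≤ n - i)).card := by
    rw [Finset.filter_or]; exact Finset.card_union_le _ _
  have rA := rawA (n := n) I hs hp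
  have rB := rawB (n := n) I hs hp
  rcases dichotomy (n := n) hs hp with hA | hB
  · have key : (I.filter fun i => (ap ≤ i ∧ ¬ c ≤ n - i ∧ ¬ bp ≤ i ∧ d ≤ n - i)).card + (I.filter fun i => (a ≤ i ∧ ¬ cp ≤ n - i ∧ ¬ b ≤ i ∧ dp
      ≤ n - i)).card + (I.filter fun i => (aP ≤ i ∧ ¬ cA ≤ n - i ∧ ¬ bP ≤ i ∧ dA ≤ n - i)).card +
        (I.filter fun i => (aA ≤ i ∧ ¬ cP ≤ n - i ∧ ¬ bA ≤ i ∧ dP ≤ n - i)).card ≤ (I.filter fun i => ((ap ≤ i ∧ ¬ c ≤ n - i ∧ bp ≤ i ∧ ¬ d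
            ≤ n - i) ∨ (¬ ap ≤ i ∧ c ≤ n - i ∧ ¬ bp ≤ i ∧ d ≤ n - i))).card + (I.filter fun i => ((a ≤ i ∧ ¬ cp ≤ n - i ∧ b ≤ i ∧ ¬ dp
            ≤ n - i) ∨ (¬ a ≤ i ∧ cp ≤ n - i ∧ ¬ b ≤ i ∧ dp ≤ n - i))).card +
        (I.filter fun i => ((aP ≤ i ∧ ¬ cA ≤ n - i ∧ bP ≤ i ∧ ¬ dA ≤ n - i) ∨ (¬ aP ≤ i ∧ cA ≤ n - i ∧ ¬ bP ≤ i ∧ dA ≤ n - i))).card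
            + (I.filter fun i => ((aA ≤ i ∧ ¬ cP ≤ n - i ∧ bA ≤ i ∧ ¬ dP ≤ n - i) ∨ (¬ aA ≤ i ∧ cP ≤ n - i ∧ ¬ bA ≤ i ∧ dP ≤ n - i))).card
            := sum4_le I _ _ _ _ _ _ _ _ hA
    omega
  · have key : (I.filter fun i => (¬ ap ≤ i ∧ c ≤ n - i ∧ bp ≤ i ∧ ¬ d ≤ n - i)).card + (I.filter fun i => (¬ a ≤ i ∧ cp ≤ n - i ∧ b ≤ i ∧ ¬ dp
      ≤ n - i)).card + (I.filter fun i => (¬ aP ≤ i ∧ cA ≤ n - i ∧ bP ≤ i ∧ ¬ dA ≤ n - i)).card +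
        (I.filter fun i => (¬ aA ≤ i ∧ cP ≤ n - i ∧ bA ≤ i ∧ ¬ dP ≤ n - i)).card ≤ (I.filter fun i => ((ap ≤ i ∧ ¬ c ≤ n - i ∧ bp ≤ i ∧ ¬ d
            ≤ n - i) ∨ (¬ ap ≤ i ∧ c ≤ n - i ∧ ¬ bp ≤ i ∧ d ≤ n - i))).card + (I.filter fun i => ((a ≤ i ∧ ¬ cp ≤ n - i ∧ b ≤ i ∧ ¬ dp
            ≤ n - i) ∨ (¬ a ≤ i ∧ cp ≤ n - i ∧ ¬ b ≤ i ∧ dp ≤ n - i))).card +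
        (I.filter fun i => ((aP ≤ i ∧ ¬ cA ≤ n - i ∧ bP ≤ i ∧ ¬ dA ≤ n - i) ∨ (¬ aP ≤ i ∧ cA ≤ n - i ∧ ¬ bP ≤ i ∧ dA ≤ n - i))).card
            + (I.filter fun i => ((aA ≤ i ∧ ¬ cP ≤ n - i ∧ bA ≤ i ∧ ¬ dP ≤ n - i) ∨ (¬ aA ≤ i ∧ cP ≤ n - i ∧ ¬ bA ≤ i ∧ dP ≤ n - i))).card
            := sum4_le I _ _ _ _ _ _ _ _ hB
    omega

end LamCount

end Antithetic

end Summit.CriticalPhenomena.PercolationContinuityZ3.Theorems
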